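/-
COR-CM (cell pub-hodgecm2) — Δ2 ORIENTATION RE-KEY, hΘ′ DISCHARGE ROUTE 1 (TRANSPORT): (P1) THE TRANSPORT ITSELF.
Seat prover-pub-hodgecm2-d2bridge-htheta-1 g0, 2026-08-23.  NEW additive leaf; THEOREMS ONLY, explicit binders; imports the LANDED
junction module `HodgeCM.Model.HThetaJunctionR2B` (supply of record ✔ `SInstance.hJ_ROGT'C_block`), ✔ `CorCM/D2Bridge/TowerConj` (the
antilinear involution `F∞` of the tower) and ✔ `CorCM/D2Bridge/Thm418CConjTransport` (the abstract block-transport law).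
FRAMING: HC_CM is NOT proved; «Δ2 BRIDGE CLOSED» is NOT claimed; HELD pending orientation re-key.
-/
import Summits.HodgeConjecture.HodgeCM.Model.HThetaJunctionR2B
import Summits.HodgeConjecture.CorCM.D2Bridge.TowerConj
import Summits.HodgeConjecture.CorCM.D2Bridge.Thm418CConjTransport

set_option autoImplicit false

/-!
# hΘ′ discharge route 1, (P1): `F∞` carries the isometric theta supply to the CONJUGATE classes in the anti-isometric block

For the statement families see `CorCM/Rekey/HThetaAntiConj.lean` (`SInstance.HThetaAntiConj`, `SInstance.OmegaConjSocket`; this file does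
not import it and spells both out, so that it lands as a pure-proof leaf — every conclusion below is the body of the corresponding `abbrev`
token for token, hence usable wherever the `abbrev` is expected).

* `block_map_conjTower_le_of_omegaConjSocket` — at ANY index type `I`, lines `line : I → SplitLineE V` and two indices `j₀ j`: if every
  oscillator module `Ω(line j₀, χ)` (`χ` automorphic) is a conjugate-linear `ℂ[U(V)(𝔸_f)]`-equivariant quotient of some `Ω(line j, χ′)`
  (`χ′` automorphic) — the ω-SOCKET — then `F∞ (block j₀) ⊆ block j` for the pinned dictionary (✔ `map_block_le_of_conjTransport` at
  `φ := MulEquiv.refl`, `eH := conjTower`, equivariance ✔ `conjTower_of_smul`).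
* `exists_conjLift_mem_block_of_omegaConjSocket` — one class: a tower family `cf` at level `Γ` with `ofLevel cf ∈ block j₀` yields the family
  `conjLevel cf` with `res (conjLevel cf) = conj (res cf)` (✔ `res_conjLevel`) and `ofLevel (conjLevel cf) = F∞ (ofLevel cf) ∈ block j`
  (✔ `conjTower_ofLevel`).
* **`hThetaAntiConj_of_omegaConjSocket`** — AT A GOOD CONTEXT `(V, c, i)` (`GOG V c`, `V` anisotropic): if the isometric theta index `j₀`
  of ✔ `hJ_ROGT'C_block` (indeed every index isometric to the slot line) has an ANTI-isometric partner `j` carrying the ω-socket, then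
  `SInstance.HThetaAntiConj … V c i` holds: every theta class `ω` of `SROGT'C` at slot `i`, every level below conj-three, has its conjugate
  class `conj ω` realised as `res` of a tower family inside `block j`.  ALL INPUTS OF THIS THEOREM OTHER THAN THE ω-SOCKET ARE LANDED.
What the ω-socket needs (not here): the conjugate pair splitting as an index of `LiuIndex.I V (repAt a_i) (muLiu ι₁ rep)` of Gram class
`−[a_i]` and the semilinear descent `eΩ` of `C_f` (✔ `finSBConjₛₗ`, ✔ `finSBConj_finRepMp`, ✔ `SplitLine.exists_Ω_semilinearEquiv`).
-/

noncomputable section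

open NumberField NumberField.InfinitePlace NumberField.mixedEmbedding IsDedekindDomain
open scoped Matrix Classical TensorProduct SchwartzMap
open MulAction
open Literature.Geometry.ComplexHyperbolic.BallModel (U21 x₀ stabilizerEquivK21)
open Literature.NumberTheory.Automorphic.U21 (K21 matA sclD)
open Literature.AlgebraicGeometry.ShimuraVarieties Literature.AlgebraicGeometry.ShimuraVarieties.BallForms
open Literature.AlgebraicGeometry.HodgeTheory Literature.NumberTheory.Automorphic.PicardCM
open Literature.NumberTheory.Transcendental (Arapura2012_Cor_15_4_6)
open Literature.NumberTheory.Automorphic Literature.NumberTheory.Automorphic.UnitaryGroup Literature.NumberTheory.Weil1964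
open Literature.NumberTheory.GelbartRogawski1991 Literature.NumberTheory.GelbartRogawski1991.UnitaryDualPair
open HodgeCM.Adelic HodgeCM.PerL34 HodgeCM.Model.HypCensus HodgeCM.Model.SupplyInstance HodgeCM.Model.ArchSideTerm
open HodgeCM.Model.ThetaSpace HodgeCM.Model.TowerLevel HodgeCM.Model.TowerCarrier HodgeCM.Literature.Theta

namespace HodgeCM.Model.Rekey.SInstance

open HodgeCM.Model HodgeCM.Model.SInstance HodgeCM.Model.ThetaAdelicSide HodgeCM.Model.LiuIndex
open Literature.AlgebraicGeometry.Motives (HodgeStructure)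
open Summit.HodgeConjecture.CorCM.D2Bridge.TowerConj
open HodgeCM.Literature.Theta.LiuAlbaneseModuleDatum.D2Bridge (map_block_le_of_conjTransport)

/-! ## §1 The block law of `F∞` at the pinned dictionary from the ω-socket (any index type) -/

/-- **`F∞ (block j₀) ⊆ block j` at the pinned dictionary**, from the ω-socket between `j₀` and `j`: every `Ω(line j₀, χ)`, `χ` automorphic,
is a conjugate-linear `ℂ[U(V)(𝔸_f)]`-equivariant quotient of some `Ω(line j, χ′)`, `χ′` automorphic (✔ `map_block_le_of_conjTransport` at
`φ := MulEquiv.refl`, `eH := conjTower`). [folklore] -/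
theorem block_map_conjTower_le_of_omegaConjSocket (hHD : exists_isReal_hodgeModel) (hI : hodgePQ_independent_of_hodgeModel)
    (h₁ : BallQuotientUniformised) (h₃ : CMAbelianVarietyRealised) (hA : Arapura2012_Cor_15_4_6)
    {L : CMField} {ι₁ : L →+* ℂ} (V : HermSpace3 L ι₁) (I : Type) (line : I → SplitLineE V) (j₀ j : I)
    (hΩ : ∀ χ : (liuDictionaryPin hHD hI h₁ h₃ hA V I line).Adm j₀,
      ∃ (χ' : (liuDictionaryPin hHD hI h₁ h₃ hA V I line).Adm j)
        (θ : (liuDictionaryPin hHD hI h₁ h₃ hA V I line).Ω j χ' →ₗ⋆[ℂ] (liuDictionaryPin hHD hI h₁ h₃ hA V I line).Ω j₀ χ),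
        Function.Surjective θ ∧
          ∀ (g : ↥V.adelicFin) (y : (liuDictionaryPin hHD hI h₁ h₃ hA V I line).Ω j χ'),
            θ (MonoidAlgebra.of ℂ ↥V.adelicFin g • y) = MonoidAlgebra.of ℂ ↥V.adelicFin g • θ y) :
    ((liuDictionaryPin hHD hI h₁ h₃ hA V I line).block j₀).map
        (conjTower hHD hI (ballQuotientUniformisedDatum_of h₁) h₃ hA :
          (liuDictionaryPin hHD hI h₁ h₃ hA V I line).H →ₗ⋆[ℂ] (liuDictionaryPin hHD hI h₁ h₃ hA V I line).H) ≤
      (liuDictionaryPin hHD hI h₁ h₃ hA V I line).block j := by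
  refine map_block_le_of_conjTransport (liuDictionaryPin hHD hI h₁ h₃ hA V I line).toLiuAlbaneseModuleDatum
    (liuDictionaryPin hHD hI h₁ h₃ hA V I line).toLiuAlbaneseModuleDatum (MulEquiv.refl _)
    (conjTower hHD hI (ballQuotientUniformisedDatum_of h₁) h₃ hA) (fun g x => ?_) j₀ j fun χ => ?_
  · exact conjTower_of_smul hHD hI (ballQuotientUniformisedDatum_of h₁) h₃ hA g x
  · obtain ⟨χ', θ, hθ, hθG⟩ := hΩ χ
    exact ⟨χ', θ, hθ, fun g y => hθG g y⟩

/-- **One class through `F∞`**: a tower family `cf` at level `Γ` whose image lies in `block j₀` yields, under the ω-socket, the family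
`conjLevel cf` with `res (conjLevel cf) = conj (res cf)` and image `F∞ (ofLevel cf) ∈ block j`. [folklore] -/
theorem exists_conjLift_mem_block_of_omegaConjSocket (hHD : exists_isReal_hodgeModel) (hI : hodgePQ_independent_of_hodgeModel)
    (h₁ : BallQuotientUniformised) (h₃ : CMAbelianVarietyRealised) (hA : Arapura2012_Cor_15_4_6)
    {L : CMField} {ι₁ : L →+* ℂ} (V : HermSpace3 L ι₁) (I : Type) (line : I → SplitLineE V) (j₀ j : I)
    (hΩ : ∀ χ : (liuDictionaryPin hHD hI h₁ h₃ hA V I line).Adm j₀,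
      ∃ (χ' : (liuDictionaryPin hHD hI h₁ h₃ hA V I line).Adm j)
        (θ : (liuDictionaryPin hHD hI h₁ h₃ hA V I line).Ω j χ' →ₗ⋆[ℂ] (liuDictionaryPin hHD hI h₁ h₃ hA V I line).Ω j₀ χ),
        Function.Surjective θ ∧
          ∀ (g : ↥V.adelicFin) (y : (liuDictionaryPin hHD hI h₁ h₃ hA V I line).Ω j χ'),
            θ (MonoidAlgebra.of ℂ ↥V.adelicFin g • y) = MonoidAlgebra.of ℂ ↥V.adelicFin g • θ y)
    {Γ : Level V} (hΓ : Γ.BelowConjThree) (cf : towerLevel hHD hI (ballQuotientUniformisedDatum_of h₁) h₃ hA Γ hΓ)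
    (hcf : (ofLevel hHD hI (ballQuotientUniformisedDatum_of h₁) h₃ hA Γ hΓ cf : (liuDictionaryPin hHD hI h₁ h₃ hA V I line).H) ∈
      (liuDictionaryPin hHD hI h₁ h₃ hA V I line).block j₀) :
    ∃ cf' : towerLevel hHD hI (ballQuotientUniformisedDatum_of h₁) h₃ hA Γ hΓ,
      TowerLevel.res hHD hI (ballQuotientUniformisedDatum_of h₁) h₃ hA cf' =
          HodgeStructure.conj (TowerLevel.res hHD hI (ballQuotientUniformisedDatum_of h₁) h₃ hA cf) ∧
        (ofLevel hHD hI (ballQuotientUniformisedDatum_of h₁) h₃ hA Γ hΓ cf' : (liuDictionaryPin hHD hI h₁ h₃ hA V I line).H) ∈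
          (liuDictionaryPin hHD hI h₁ h₃ hA V I line).block j := by
  refine ⟨conjLevel hHD hI (ballQuotientUniformisedDatum_of h₁) h₃ hA Γ hΓ cf,
    res_conjLevel hHD hI (ballQuotientUniformisedDatum_of h₁) h₃ hA cf, ?_⟩
  rw [← conjTower_ofLevel]
  exact block_map_conjTower_le_of_omegaConjSocket hHD hI h₁ h₃ hA V I line j₀ j hΩ ⟨_, hcf, rfl⟩

/-! ## §2 At a good context: `SInstance.HThetaAntiConj` from the supply of record and the ω-socket -/

/-- **(P1) `hΘ′ᶜ` FROM THE SUPPLY OF RECORD BY TRANSPORT.**  At a good context `(V, c, i)` (`GOG V c`, `V` anisotropic): if every index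
`j₀` of the pinned family at `a_i` ISOMETRIC to the slot line has an ANTI-isometric partner `j` carrying the ω-socket (every
`Ω(line j₀, χ)` a conjugate-linear equivariant quotient of some `Ω(line j, χ′)`), then `SInstance.HThetaAntiConj … V c i` holds — the body
below is that `abbrev` verbatim: ✔ `hJ_ROGT'C_block` gives `j₀` and, for each theta class `ω`, a family `cf₀` with `res cf₀ = ω`,
`ofLevel cf₀ ∈ block j₀`; `conjLevel cf₀` has `res = conj ω` and `ofLevel (conjLevel cf₀) = F∞ (ofLevel cf₀) ∈ F∞ (block j₀) ⊆ block j`.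
[folklore] -/
theorem hThetaAntiConj_of_omegaConjSocket (hHD : exists_isReal_hodgeModel) (hI : hodgePQ_independent_of_hodgeModel)
  (h₁ : BallQuotientUniformised) (h₃ : CMAbelianVarietyRealised) (hA : Arapura2012_Cor_15_4_6)

  (hGR : ∀ {L : CMField} {ι₁ : L →+* ℂ} (V : HermSpace3 L ι₁) (c : SeesawCtx L),
    (cmSplittingDatum (L : Type) finProdFinEquiv (frameD V) (frameD_real V) (frameD_ne V) (dW c.D) (dW_real c.D)
      (dW_ne c.D)).CompatibleSplitting)
  (hGR₀ : ∀ {L : CMField} {ι₁ : L →+* ℂ} (V : HermSpace3 L ι₁) (c : SeesawCtx L),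
    (cmSplittingDatum (L : Type) (e₁) (frameD V) (frameD_real V) (frameD_ne V) (lineVec (L : Type) (dW c.D 0))
      (fun _ => dW_real c.D 0) (fun _ => dW_ne c.D 0)).CompatibleSplitting)
  (hGR₁ : ∀ {L : CMField} {ι₁ : L →+* ℂ} (V : HermSpace3 L ι₁) (c : SeesawCtx L),
    (cmSplittingDatum (L : Type) (e₁) (frameD V) (frameD_real V) (frameD_ne V) (lineVec (L : Type) (dW c.D 1))
      (fun _ => dW_real c.D 1) (fun _ => dW_ne c.D 1)).CompatibleSplitting)
  (hGR₂ : ∀ {L : CMField} {ι₁ : L →+* ℂ} (V : HermSpace3 L ι₁) (c : SeesawCtx L),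
    (cmSplittingDatum (L : Type) (e₁) (frameD V) (frameD_real V) (frameD_ne V) (lineVec (L : Type) (dW' c.D 0))
      (fun _ => dW'_real c.D 0) (fun _ => dW'_ne c.D 0)).CompatibleSplitting)
  (hGR₃ : ∀ {L : CMField} {ι₁ : L →+* ℂ} (V : HermSpace3 L ι₁) (c : SeesawCtx L),
    (cmSplittingDatum (L : Type) (e₁) (frameD V) (frameD_real V) (frameD_ne V) (lineVec (L : Type) (dW' c.D 1))
      (fun _ => dW'_real c.D 1) (fun _ => dW'_ne c.D 1)).CompatibleSplitting)
  (μ : ∀ {L : CMField}, SeesawCtx L → Fin 4 → NumberField.InfinitePlace (L : Type) → ℤ)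
  (hΔ₁ : ∀ {L : CMField} {ι₁ : L →+* ℂ} (V : HermSpace3 L ι₁) (c : SeesawCtx L), ∀ hc : GOG V c,
    slotTypeVec V c (hGR V c) (hGR₀ V c) (hGR₁ V c) (hGR₂ V c) (hGR₃ V c) (hG_GOG V c hc) 1 -
      slotTypeVec V c (hGR V c) (hGR₀ V c) (hGR₁ V c) (hGR₂ V c) (hGR₃ V c) (hG_GOG V c hc) 0 = μ c 1 - μ c 0)
  (hΔ₂ : ∀ {L : CMField} {ι₁ : L →+* ℂ} (V : HermSpace3 L ι₁) (c : SeesawCtx L), ∀ hc : GOG V c,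
    slotTypeVec V c (hGR V c) (hGR₀ V c) (hGR₁ V c) (hGR₂ V c) (hGR₃ V c) (hG_GOG V c hc) 2 -
      slotTypeVec V c (hGR V c) (hGR₀ V c) (hGR₁ V c) (hGR₂ V c) (hGR₃ V c) (hG_GOG V c hc) 0 = μ c 2 - μ c 0)
  (hΔ₃ : ∀ {L : CMField} {ι₁ : L →+* ℂ} (V : HermSpace3 L ι₁) (c : SeesawCtx L), ∀ hc : GOG V c,
    slotTypeVec V c (hGR V c) (hGR₀ V c) (hGR₁ V c) (hGR₂ V c) (hGR₃ V c) (hG_GOG V c hc) 3 -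
      slotTypeVec V c (hGR V c) (hGR₀ V c) (hGR₁ V c) (hGR₂ V c) (hGR₃ V c) (hG_GOG V c hc) 0 = μ c 3 - μ c 0)
    {L : CMField} {ι₁ : L →+* ℂ} (V : HermSpace3 L ι₁) (c : SeesawCtx L) (hc : GOG V c) (hV : IsAnisotropic L V.Hm) (i : Fin 4)
    (hΩ : ∀ j₀ : LiuIndex.I V (LiuIndex.repAt (⟨c.D.a i, c.D.a_real i, c.D.a_ne i⟩ : LiuIndex.RealScalar L))
        (muLiu ι₁ LiuIndex.GramClass.rep),
      (∃ z : (L : Type), z ≠ 0 ∧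
        (LiuIndex.line V (LiuIndex.repAt (⟨c.D.a i, c.D.a_real i, c.D.a_ne i⟩ : LiuIndex.RealScalar L))
          (muLiu ι₁ LiuIndex.GramClass.rep) j₀).scalar = z * conjRingHomK L z * c.D.a i) →
      ∃ j : LiuIndex.I V (LiuIndex.repAt (⟨c.D.a i, c.D.a_real i, c.D.a_ne i⟩ : LiuIndex.RealScalar L))
          (muLiu ι₁ LiuIndex.GramClass.rep),
        (∃ z : (L : Type), z ≠ 0 ∧
          (LiuIndex.line V (LiuIndex.repAt (⟨c.D.a i, c.D.a_real i, c.D.a_ne i⟩ : LiuIndex.RealScalar L))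
            (muLiu ι₁ LiuIndex.GramClass.rep) j).scalar = -(z * conjRingHomK L z * c.D.a i)) ∧
        ∀ χ : (liuDictionaryPin hHD hI h₁ h₃ hA V
                (LiuIndex.I V (LiuIndex.repAt (⟨c.D.a i, c.D.a_real i, c.D.a_ne i⟩ : LiuIndex.RealScalar L))
                  (muLiu ι₁ LiuIndex.GramClass.rep))
                (LiuIndex.line V (LiuIndex.repAt (⟨c.D.a i, c.D.a_real i, c.D.a_ne i⟩ : LiuIndex.RealScalar L))
                  (muLiu ι₁ LiuIndex.GramClass.rep))).Adm j₀,
          ∃ (χ' : (liuDictionaryPin hHD hI h₁ h₃ hA V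
                (LiuIndex.I V (LiuIndex.repAt (⟨c.D.a i, c.D.a_real i, c.D.a_ne i⟩ : LiuIndex.RealScalar L))
                  (muLiu ι₁ LiuIndex.GramClass.rep))
                (LiuIndex.line V (LiuIndex.repAt (⟨c.D.a i, c.D.a_real i, c.D.a_ne i⟩ : LiuIndex.RealScalar L))
                  (muLiu ι₁ LiuIndex.GramClass.rep))).Adm j)
            (θ : (liuDictionaryPin hHD hI h₁ h₃ hA V
                (LiuIndex.I V (LiuIndex.repAt (⟨c.D.a i, c.D.a_real i, c.D.a_ne i⟩ : LiuIndex.RealScalar L))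
                  (muLiu ι₁ LiuIndex.GramClass.rep))
                (LiuIndex.line V (LiuIndex.repAt (⟨c.D.a i, c.D.a_real i, c.D.a_ne i⟩ : LiuIndex.RealScalar L))
                  (muLiu ι₁ LiuIndex.GramClass.rep))).Ω j χ' →ₗ⋆[ℂ]
              (liuDictionaryPin hHD hI h₁ h₃ hA V
                (LiuIndex.I V (LiuIndex.repAt (⟨c.D.a i, c.D.a_real i, c.D.a_ne i⟩ : LiuIndex.RealScalar L))
                  (muLiu ι₁ LiuIndex.GramClass.rep))
                (LiuIndex.line V (LiuIndex.repAt (⟨c.D.a i, c.D.a_real i, c.D.a_ne i⟩ : LiuIndex.RealScalar L))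
                  (muLiu ι₁ LiuIndex.GramClass.rep))).Ω j₀ χ),
            Function.Surjective θ ∧
              ∀ (g : ↥V.adelicFin) (y : (liuDictionaryPin hHD hI h₁ h₃ hA V
                (LiuIndex.I V (LiuIndex.repAt (⟨c.D.a i, c.D.a_real i, c.D.a_ne i⟩ : LiuIndex.RealScalar L))
                  (muLiu ι₁ LiuIndex.GramClass.rep))
                (LiuIndex.line V (LiuIndex.repAt (⟨c.D.a i, c.D.a_real i, c.D.a_ne i⟩ : LiuIndex.RealScalar L))
                  (muLiu ι₁ LiuIndex.GramClass.rep))).Ω j χ'),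
                θ (MonoidAlgebra.of ℂ ↥V.adelicFin g • y) = MonoidAlgebra.of ℂ ↥V.adelicFin g • θ y) :
    ∃ j : LiuIndex.I V (LiuIndex.repAt (⟨c.D.a i, c.D.a_real i, c.D.a_ne i⟩ : LiuIndex.RealScalar L))
        (muLiu ι₁ LiuIndex.GramClass.rep),
      (∃ z : (L : Type), z ≠ 0 ∧
        (LiuIndex.line V (LiuIndex.repAt (⟨c.D.a i, c.D.a_real i, c.D.a_ne i⟩ : LiuIndex.RealScalar L))
          (muLiu ι₁ LiuIndex.GramClass.rep) j).scalar = -(z * conjRingHomK L z * c.D.a i)) ∧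
      ∀ (Γ : Level V) (hΓ : Γ.BelowConjThree),
        ∀ ω ∈ thetaOf _ (thetaClassInputOf _ (fun V c => thetaSpaceInputOf hHD hI h₁ h₃
            (SROGT'C @hGR @hGR₀ @hGR₁ @hGR₂ @hGR₃ @μ hΔ₁ hΔ₂ hΔ₃) V c)) V c i Γ,
          ∃ cf : towerLevel hHD hI (ballQuotientUniformisedDatum_of h₁) h₃ hA Γ hΓ,
            TowerLevel.res hHD hI (ballQuotientUniformisedDatum_of h₁) h₃ hA cf = HodgeStructure.conj ω ∧
              (ofLevel hHD hI (ballQuotientUniformisedDatum_of h₁) h₃ hA Γ hΓ cf :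
                  (liuDictionaryPin hHD hI h₁ h₃ hA V
                (LiuIndex.I V (LiuIndex.repAt (⟨c.D.a i, c.D.a_real i, c.D.a_ne i⟩ : LiuIndex.RealScalar L))
                  (muLiu ι₁ LiuIndex.GramClass.rep))
                (LiuIndex.line V (LiuIndex.repAt (⟨c.D.a i, c.D.a_real i, c.D.a_ne i⟩ : LiuIndex.RealScalar L))
                  (muLiu ι₁ LiuIndex.GramClass.rep))).H) ∈
                (liuDictionaryPin hHD hI h₁ h₃ hA V
                (LiuIndex.I V (LiuIndex.repAt (⟨c.D.a i, c.D.a_real i, c.D.a_ne i⟩ : LiuIndex.RealScalar L))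
                  (muLiu ι₁ LiuIndex.GramClass.rep))
                (LiuIndex.line V (LiuIndex.repAt (⟨c.D.a i, c.D.a_real i, c.D.a_ne i⟩ : LiuIndex.RealScalar L))
                  (muLiu ι₁ LiuIndex.GramClass.rep))).block j := by
  obtain ⟨j₀, hj₀, hfam⟩ := hJ_ROGT'C_block hHD hI h₁ h₃ hA @hGR @hGR₀ @hGR₁ @hGR₂ @hGR₃ @μ hΔ₁ hΔ₂ hΔ₃ V c hc hV i
  obtain ⟨j, hj, hsock⟩ := hΩ j₀ hj₀
  refine ⟨j, hj, fun Γ hΓ ω hω => ?_⟩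
  obtain ⟨cf, hres, hblk⟩ := hfam Γ hΓ ω hω
  obtain ⟨cf', hres', hblk'⟩ := exists_conjLift_mem_block_of_omegaConjSocket hHD hI h₁ h₃ hA V _ _ j₀ j hsock hΓ cf hblk
  exact ⟨cf', hres'.trans (congrArg HodgeStructure.conj hres), hblk'⟩

end HodgeCM.Model.Rekey.SInstance

end
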